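import Literature.AlgebraicGeometry.Resolution.Blowups
import Literature.AlgebraicGeometry.Resolution.BlowupsProduct
import Literature.AlgebraicGeometry.Resolution.BlowupsIntegral
import Literature.AlgebraicGeometry.Resolution.BlowupsExistence
import Literature.AlgebraicGeometry.Resolution.BlowupsFlatBaseChange
import Summits.ResolutionOfSingularities.ResolutionOfSingularities.Theorems.PatchingRelPerfect.Negative.PunctualAtom
import Summits.ResolutionOfSingularities.ResolutionOfSingularities.Theorems.SectionAscentFibrewiseClosedPointsTraceIdealAssembly
import Summits.ResolutionOfSingularities.ResolutionOfSingularities.Theorems.SectionAscentAffineToGlobalYardstickModel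
import Literature.AlgebraicGeometry.Resolution.BlowupsScaling
import Literature.AlgebraicGeometry.Resolution.AffineBlowupUnique
import Literature.AlgebraicGeometry.Resolution.KollarFunctorLinearCentre
import Literature.AlgebraicGeometry.Resolution.ProjectiveSpaceRegular
import HarnessLib

/-!
# Crux `PatchingRelPerfect` (stmt-ResolutionOfSingularities-16161), chain w52, task W2:
# the Stacks-080A KERNEL — a regularizing COMPANION ideal gives the atom in blow-up form

[OURS · L1 W5.2 · W2] For the planner's blow-up form of the open core (`stub_atomDimFourBlowup`,
CHAIN.md §3 P0): let `S` be a local domain, `f : T ⟶ Spec S` a blow-up along an ideal sheaf `I`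
(`T = Bl_I S`), and suppose `I` has a **companion** `Q` — a non-zero ideal sheaf on `Spec S`
cosupported at the closed point such that the blow-up of `Spec S` along the PRODUCT `I·Q` has
regular source. Then the atom's conclusion holds for `T`: the ideal sheaf `J = Q 𝒪_T` is
non-zero, cosupported in the closed fibre, and its blowing up `Bl_J T ≅ Bl_{IQ} S` (Stacks 080A,
tree `IsBlowup.comp`, with uniqueness of blow-ups) is regular.  So on the stratum of BLOW-UPS the
open core is literally a statement about ideals of `κ[[x₁,…,x₄]]`: "every non-zero `I` whose
blow-up is regular off `V(𝔪)` has a regularizing companion `Q` concentrated at `𝔪`"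
(`Lines/closed-point-slice-core.md` §1, kernel for blow-ups).

Everything is proved in all dimensions and for every local domain `S`; nothing is assumed.
* `atomConclusion_of_companion` — the kernel (W2; tree lemmas reused: `mul_ne_bot` for ideal
  sheaves on integral schemes, `isRegular_of_iso`);
* `atomConclusion_of_companion_regularLocal` — the same over a regular local base (the atom's `S`).

## References

* The Stacks Project, Tag 080A (blowing up in a product of ideals), Tag 02ND. [StacksProject]
* U. Görtz, T. Wedhorn, *Algebraic Geometry I* (2nd ed., 2020), Def. 13.90 and (13.19)
  (uniqueness of blow-ups). [GortzWedhorn2020]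
-/

-- `Summit.<Summit>.<Sub>.Theorems` with `Sub = Summit` (single-conjunct summit, D-0017)
set_option linter.dupNamespace false

noncomputable section

open CategoryTheory CategoryTheory.Limits AlgebraicGeometry Literature.AlgebraicGeometry.Resolution
open Summit.ResolutionOfSingularities.ResolutionOfSingularities.Theorems.PatchingRelPerfect.Negative

namespace Summit.ResolutionOfSingularities.ResolutionOfSingularities.Theorems

universe u

/-- **W2 — the 080A kernel.** Let `S` be a local domain, `f : T ⟶ Spec S` a blow-up along `I`,
and `Q` a non-zero ideal sheaf on `Spec S`, cosupported at the closed point, such that SOME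
blow-up `σ : Y ⟶ Spec S` along `I * Q` has regular source. Then there is a non-zero ideal sheaf
`J` on `T` (namely `Q 𝒪_T`), cosupported in the closed fibre of `f`, and a blow-up `π : T' ⟶ T`
along `J` with `T'` regular: `π ≫ f` is a blow-up along `I * Q` (Stacks 080A), hence `T' ≅ Y`
over `Spec S` by uniqueness of blow-ups; `T'` is non-empty because `Y = Bl_{IQ} S` is integral
(`I * Q ≠ 0`), so `J ≠ 0`. This is the conclusion of the registered atom `stub_atomDimFour` for
`T`, obtained from a COMPANION of `I`. [cite: StacksProject, Tag 080A]
[cite: GortzWedhorn2020, (13.19) p. 413] -/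
theorem atomConclusion_of_companion {S : Type u} [CommRing S] [IsDomain S] [IsLocalRing S]
    {T : Scheme.{u}} {f : T ⟶ Spec (.of S)} {I : (Spec (.of S)).IdealSheafData}
    (hf : IsBlowup f I) (hI : I ≠ ⊥) {Q : (Spec (.of S)).IdealSheafData} (hQ : Q ≠ ⊥)
    (hQsupp : ∀ s : Spec (.of S), s ∈ Q.support → s = IsLocalRing.closedPoint S)
    {Y : Scheme.{u}} {σ : Y ⟶ Spec (.of S)} (hσ : IsBlowup σ (I * Q))
    (hY : Scheme.IsRegular Y) :
    ∃ (J : T.IdealSheafData) (T' : Scheme.{u}) (π : T' ⟶ T), J ≠ ⊥ ∧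
      (∀ t : T, t ∈ J.support → f.base t = IsLocalRing.closedPoint S) ∧
      IsBlowup π J ∧ Scheme.IsRegular T' := by
  haveI : IsDomain (CommRingCat.of S) := inferInstanceAs (IsDomain S)
  haveI : IsIntegral (Spec (.of S)) := inferInstance
  -- the source of the regularizing blow-up is non-empty
  haveI : IsIntegral Y := hσ.isIntegral (AffineToGlobal.YardstickModel.mul_ne_bot hI hQ)
  -- blow `T` up along `Q 𝒪_T`
  obtain ⟨T', π, hπ⟩ := exists_isBlowup T (Q.comap f)
  -- `π ≫ f` is a blow-up of `Spec S` along `I * Q` (Stacks 080A), hence `T' ≅ Y`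
  obtain ⟨e, -, -⟩ := (hf.comp hπ).unique hσ
  haveI : Nonempty T' := ⟨e.inv (Classical.arbitrary Y)⟩
  refine ⟨Q.comap f, T', π, isBlowup_ne_bot_of_nonempty hπ, fun t ht => ?_, hπ,
    SectionAscent.TraceIdeal.isRegular_of_iso e hY⟩
  rw [Scheme.IdealSheafData.support_comap] at ht
  exact hQsupp _ ht

/-- **W2 over a regular local base** (the shape of the atom `stub_atomDimFour`'s `S`): for
`S` regular local, `T ⟶ Spec S` a blow-up along `I ≠ 0`, and a companion `Q ≠ 0` of `I`
cosupported at the closed point with `Bl_{IQ} S` regular, the atom's conclusion holds for `T`.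
[cite: StacksProject, Tag 080A] -/
theorem atomConclusion_of_companion_regularLocal {S : Type u} [CommRing S] [IsRegularLocalRing S]
    {T : Scheme.{u}} {f : T ⟶ Spec (.of S)} {I : (Spec (.of S)).IdealSheafData}
    (hf : IsBlowup f I) (hI : I ≠ ⊥) {Q : (Spec (.of S)).IdealSheafData} (hQ : Q ≠ ⊥)
    (hQsupp : ∀ s : Spec (.of S), s ∈ Q.support → s = IsLocalRing.closedPoint S)
    {Y : Scheme.{u}} {σ : Y ⟶ Spec (.of S)} (hσ : IsBlowup σ (I * Q))
    (hY : Scheme.IsRegular Y) :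
    ∃ (J : T.IdealSheafData) (T' : Scheme.{u}) (π : T' ⟶ T), J ≠ ⊥ ∧
      (∀ t : T, t ∈ J.support → f.base t = IsLocalRing.closedPoint S) ∧
      IsBlowup π J ∧ Scheme.IsRegular T' := by
  haveI : IsDomain S := isDomain_of_isRegularLocalRing S
  exact atomConclusion_of_companion hf hI hQ hQsupp hσ hY


/-! ## The typed target `ChainW52.W2_CompanionKernel` (ideals of `S`, `𝔪`-primary companions) -/

/-- The cosupport of the ideal sheaf `Q~` of an `𝔪`-primary ideal `Q ⊇ 𝔪ⁿ` of a local ring `S`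
is contained in the closed point of `Spec S`. [folklore] -/
theorem support_idealSheaf_subset_closedPoint {S : Type u} [CommRing S] [IsLocalRing S]
    {Q : Ideal S} {n : ℕ} (hQ : IsLocalRing.maximalIdeal S ^ n ≤ Q) (s : Spec (.of S))
    (hs : s ∈ (affineBlowup.idealSheaf Q).support) : s = IsLocalRing.closedPoint S := by
  have hs' : s ∈ ((affineBlowup.idealSheaf Q).support : Set (Spec (.of S))) := hs
  rw [affineBlowup.support_idealSheaf] at hs'
  have hQs : Q ≤ s.asIdeal := hs'
  have hpow : IsLocalRing.maximalIdeal S ^ n ≤ s.asIdeal := hQ.trans hQs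
  haveI : s.asIdeal.IsPrime := s.isPrime
  have hle : IsLocalRing.maximalIdeal S ≤ s.asIdeal := by
    rcases Nat.eq_zero_or_pos n with h0 | hpos
    · subst h0
      rw [pow_zero, Ideal.one_eq_top, top_le_iff] at hpow
      exact (s.isPrime.ne_top hpow).elim
    · exact (Ideal.IsPrime.pow_le_iff (pos_iff_ne_zero.mp hpos)).mp hpow
  apply PrimeSpectrum.ext
  exact ((IsLocalRing.maximalIdeal.isMaximal S).eq_of_le s.isPrime.ne_top hle).symm

set_option linter.overlappingInstances false in
/-- **W2 in the typed target's shape** (`ChainW52.W2_CompanionKernel`, CHAIN.md v0.1, UNFOLDED):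
`S` a local Noetherian domain, `I ≠ 0` an ideal, `f : T ⟶ Spec S` a blowing up along `Ĩ`; if
some `𝔪`-primary ideal `Q ⊇ 𝔪ⁿ` has a REGULAR blowing up `Bl_{I·Q} Spec S`, then the atom's
conclusion holds for `T` (`J = Q·𝒪_T`, Stacks 080A). The degenerate case `Q = 0` (forcing
`𝔪 = 0`, `S` a field, `I = S`, `T ≅ Spec S`) is settled with `J = 𝒪_T`.
[cite: StacksProject, Tag 080A] -/
theorem w2_companionKernel :
    ∀ (S : Type) [CommRing S] [IsLocalRing S] [IsNoetherianRing S] [IsDomain S] (I : Ideal S),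
      I ≠ ⊥ → ∀ (T : Scheme.{0}) (f : T ⟶ Spec (.of S)),
      IsBlowup f (affineBlowup.idealSheaf I) →
      ∀ (Q : Ideal S) (n : ℕ), (IsLocalRing.maximalIdeal S) ^ n ≤ Q →
        (∃ (B : Scheme.{0}) (b : B ⟶ Spec (.of S)),
          IsBlowup b (affineBlowup.idealSheaf (I * Q)) ∧ Scheme.IsRegular B) →
        ∃ (J : T.IdealSheafData) (T' : Scheme.{0}) (π : T' ⟶ T), J ≠ ⊥ ∧
          (∀ t : T, t ∈ J.support → f.base t = IsLocalRing.closedPoint S) ∧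
          IsBlowup π J ∧ Scheme.IsRegular T' := by
  intro S _ _ _ _ I hI T f hf Q n hQn hB
  obtain ⟨B, b, hb, hBreg⟩ := hB
  by_cases hQ : Q = ⊥
  · -- degenerate case: `𝔪ⁿ = 0` in a domain forces `S` to be a field and `I = ⊤`
    subst hQ
    have hmn : IsLocalRing.maximalIdeal S ^ n = ⊥ := le_bot_iff.mp hQn
    have hm : IsLocalRing.maximalIdeal S = ⊥ := by
      rcases Nat.eq_zero_or_pos n with h0 | hpos
      · subst h0
        rw [pow_zero, Ideal.one_eq_top] at hmn
        have h1 : (1 : S) ∈ (⊥ : Ideal S) := hmn ▸ Submodule.mem_top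
        exact absurd ((Submodule.mem_bot S).mp h1) one_ne_zero
      · have h' := (pow_eq_zero_iff (pos_iff_ne_zero.mp hpos)).mp
          (hmn.trans Submodule.zero_eq_bot.symm)
        exact h'.trans Submodule.zero_eq_bot
    have hS : IsField S := IsLocalRing.isField_iff_maximalIdeal_eq.mpr hm
    have hItop : I = ⊤ := by
      letI := hS.toField
      exact (Ideal.eq_bot_or_top I).resolve_left hI
    subst hItop
    rw [affineBlowup.idealSheaf_top] at hf
    haveI : IsIso f := hf.isIso isEffectiveCartier_top
    -- `Spec S` is regular (a field is a regular ring), hence so is `T ≅ Spec S`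
    have hSreg : Scheme.IsRegular (Spec (.of S)) := by
      letI := hS.toField
      haveI : IsRegularRing (CommRingCat.of S) := inferInstanceAs (IsRegularRing S)
      exact Scheme.isRegular_Spec (.of S)
    have hT : Scheme.IsRegular T := SectionAscent.TraceIdeal.isRegular_of_iso (asIso f) hSreg
    haveI : Nonempty T := ⟨(inv f).base (IsLocalRing.closedPoint S)⟩
    refine ⟨⊤, T, 𝟙 T, isBlowup_ne_bot_of_nonempty (isBlowup_id_top T), fun t ht => ?_,
      isBlowup_id_top T, hT⟩
    exfalso
    rw [Scheme.IdealSheafData.support_top] at ht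
    have h' : t ∈ ((⊥ : TopologicalSpace.Closeds T) : Set T) := ht
    simp at h'
  · -- main case: `Q ≠ 0` is a companion in the sense of `atomConclusion_of_companion`
    rw [affineBlowup.idealSheaf_mul] at hb
    exact atomConclusion_of_companion hf (affineBlowup.idealSheaf_ne_bot hI)
      (affineBlowup.idealSheaf_ne_bot hQ) (support_idealSheaf_subset_closedPoint hQn) hb hBreg

end Summit.ResolutionOfSingularities.ResolutionOfSingularities.Theorems

end
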